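import Summits.RiemannHypothesis.RiemannHypothesis.Theorems.LiTailLaguerreFejerPieces
import Literature.Analysis.Fourier.StationaryPhaseUniform
import HarnessLib

/-!
# RiemannHypothesis / LiTailMidpoint — the stationary half of the Laguerre bridge, UNIFORMLY in the cut (RH-FREE)

RH-FREE [rh-li-eng-4 g6].  Cell `pub/rh-li`, rounds 8–9 (PART M `Theorems/LiTailMidpointDefs.lean`, route
`Theses/LiTailMidpoint.lean`, crux K2 «LiBridgeHalves»; round-9 target «uniform tail–Fresnel law», eng-6 g4 exhibits 3–4).
Pure analysis of the phase `F(t) = yt + nϑ(t)` (`Fejer.phF`, `ϑ = π − 2 arctan 2t`; eng g6's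
`Theorems/LiTailLaguerreFejer{Angle,Phase,Pieces}.lean`) with its stationary point `t₀ = √(n/y − ¼)` (`Fejer.tz`), using the
UNIFORM stationary-phase lemma `Literature.Analysis.Fourier.stationaryPhase_uniform` (incomplete Fresnel main term,
`Literature/Analysis/Fourier/StationaryPhaseUniform.lean`):

* `norm_integral_tz_right_sub_le` / `norm_integral_tz_left_sub_le` — for EVERY cut `T ∈ [t₀, 2t₀]`, resp. `T ∈ [t₀/2, t₀]`:
  `∫_{t₀}^{T} e^{iF}`, resp. `∫_{T}^{t₀} e^{iF}`, equals `e^{iF(t₀)} F''(t₀)^{−1/2} · fresnelS(√(2(F(T) − F(t₀))))` up to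
  `K_y (2 + log(1 + (|T − t₀|)√r))`, `r = n/(20t₀³)`, `K_y = 2·320³·40000/y` (on `[t₀/2, 2t₀]`: `r ≤ F'' ≤ 320 r`,
  `|F'''| ≤ 100n/t₀⁴`, so `λ₃/r² ≤ 40000/y`);
* `norm_integral_tz_Ioi_sub_le` / `norm_integral_zero_tz_sub_le` — the two COMPLETE one-sided integrals `∫_{t₀}^{L} e^{iF}`
  (`L ≥ 2t₀`) and `∫_0^{t₀} e^{iF}` both equal `e^{iF(t₀)} F''(t₀)^{−1/2} · fresnelLim` up to `O_y(1 + log n)` — THE SAME HALF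
  on either side of the stationary height (van der Corput on `[0, t₀/2]`, `[2t₀, L]` by eng g6's `norm_left_piece` /
  `norm_right_piece`; `‖fresnelS X − fresnelLim‖ ≤ 2/X`);
* `log_bound` — the bookkeeping `log(1 + 2t₀√r) ≤ 2 log n`.

Sequel `Theorems/LiTailMidpointBridgeUniform.lean` assembles the uniform law for `liBridgeTail n y T` (PART M).
Labels: RH-FREE classical analysis; nothing here bears on the truth of RH; no data of record is added or changed.
-/

noncomputable section

-- D-0017: `Summit.<S>.<S>.…` is the designed namespace of a single-problem summit.
set_option linter.dupNamespace false

open Set MeasureTheory intervalIntegral Complex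
open Literature.Analysis.Fourier

namespace Summit.RiemannHypothesis.RiemannHypothesis.Theorems.LiTheory

namespace BridgeFresnel

open Fejer

/-! ### The second derivative from above on `[t₀/2, 2t₀]` -/

/-- `ϑ''(t) ≤ 16/s³` for `t ∈ [s/2, 2s]`, `s > 0` (`ϑ''(t) = 32t/(1 + 4t²)² ≤ 2/t³`). -/
theorem angD2_le {s t : ℝ} (hs : 0 < s) (ht : t ∈ Icc (s / 2) (2 * s)) : angD2 t ≤ 16 / s ^ 3 := by
  obtain ⟨ht1, _⟩ := ht
  have ht0 : 0 < t := by linarith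
  have hu := sq_le_uS t
  have hu0 := uS_pos t
  unfold angD2
  have h1 : 32 * t / uS t ^ 2 ≤ 32 * t / (4 * t ^ 2) ^ 2 :=
    div_le_div_of_nonneg_left (by positivity) (by positivity) (pow_le_pow_left₀ (by positivity) hu 2)
  refine h1.trans ?_
  rw [show 32 * t / (4 * t ^ 2) ^ 2 = 2 / t ^ 3 by field_simp; ring]
  rw [div_le_div_iff₀ (by positivity) (by positivity)]
  have : s ^ 3 ≤ (2 * t) ^ 3 := pow_le_pow_left₀ hs.le (by linarith) 3
  nlinarith

/-- The hypotheses of the uniform stationary-phase lemma on `[t₀/2, 2t₀]`: with `r = n/(20t₀³)`,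
`r ≤ F'' ≤ 320 r` and `|F'''| ≤ 100 n/t₀⁴` (for `0 < y`, `2y ≤ n`). -/
theorem sp_hyp {n : ℕ} {y t : ℝ} (hy : 0 < y) (hn : 2 * y ≤ n) (ht : t ∈ Icc (tz n y / 2) (2 * tz n y)) :
    ((n : ℝ) / (20 * tz n y ^ 3) ≤ phF2 n t ∧ phF2 n t ≤ 320 * ((n : ℝ) / (20 * tz n y ^ 3))) ∧
      |phF3 n t| ≤ 100 * n / tz n y ^ 4 := by
  obtain ⟨h2, h3, _⟩ := gk_bounds hy hn ht
  have hs0 := tz_pos hy hn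
  refine ⟨⟨h2, ?_⟩, h3⟩
  unfold phF2
  calc (n : ℝ) * angD2 t ≤ n * (16 / tz n y ^ 3) := mul_le_mul_of_nonneg_left (angD2_le hs0 ht) n.cast_nonneg
    _ = 320 * ((n : ℝ) / (20 * tz n y ^ 3)) := by field_simp; ring

/-- The error constant: `2 · 320³ · (λ₃/r²) ≤ K_y := 2·320³·40000/y` (`λ₃/r² = 40000 t₀²/n ≤ 40000/y`). -/
theorem errConst_le {n : ℕ} {y : ℝ} (hy : 0 < y) (hn : 2 * y ≤ n) :
    2 * (320 : ℝ) ^ 3 * ((100 * n / tz n y ^ 4) / ((n : ℝ) / (20 * tz n y ^ 3)) ^ 2)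
      ≤ 2 * 320 ^ 3 * 40000 / y := by
  obtain ⟨hsq, h1, _, _⟩ := tz_facts hy hn
  have hs0 : 0 < tz n y := by linarith
  have hn0 : (0 : ℝ) < n := by have : (0 : ℝ) < 2 * y := by positivity
                               linarith
  have hs2n : tz n y ^ 2 / n ≤ 1 / y := by
    have : tz n y ^ 2 ≤ n / y := by rw [hsq]; linarith
    calc tz n y ^ 2 / n ≤ (n / y) / n := by gcongr
      _ = 1 / y := by field_simp
  have e : (100 * n / tz n y ^ 4) / ((n : ℝ) / (20 * tz n y ^ 3)) ^ 2 = 40000 * (tz n y ^ 2 / n) := by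
    field_simp; ring
  rw [e]
  calc 2 * (320 : ℝ) ^ 3 * (40000 * (tz n y ^ 2 / n)) ≤ 2 * 320 ^ 3 * (40000 * (1 / y)) := by gcongr
    _ = 2 * 320 ^ 3 * 40000 / y := by ring

/-- Bookkeeping: for `t ∈ [t₀/2, 2t₀]`, `log(1 + |t − t₀|·√r) ≤ 2 log n` (`r = n/(20t₀³)`, `0 < y`, `2y ≤ n`, `2 ≤ n`). -/
theorem log_bound {n : ℕ} {y d : ℝ} (hy : 0 < y) (hn : 2 * y ≤ n) (hn2 : 2 ≤ n) (hd0 : 0 ≤ d) (hd : d ≤ 2 * tz n y) :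
    Real.log (1 + d * Real.sqrt ((n : ℝ) / (20 * tz n y ^ 3))) ≤ 2 * Real.log n := by
  obtain ⟨hsq, h1, _, _⟩ := tz_facts hy hn
  have hs0 : 0 < tz n y := by linarith
  have hn0 : (2 : ℝ) ≤ n := by exact_mod_cast hn2
  -- `d √r ≤ 2t₀ √(n/(20 t₀³)) = √(n/(5 t₀)) ≤ √n ≤ n`, and `1 + n ≤ n²`
  have hr0 : 0 ≤ (n : ℝ) / (20 * tz n y ^ 3) := by positivity
  have hdr : d * Real.sqrt ((n : ℝ) / (20 * tz n y ^ 3)) ≤ n := by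
    have h2 : d * Real.sqrt ((n : ℝ) / (20 * tz n y ^ 3)) ≤ 2 * tz n y * Real.sqrt ((n : ℝ) / (20 * tz n y ^ 3)) :=
      mul_le_mul_of_nonneg_right hd (Real.sqrt_nonneg _)
    have h3 : 2 * tz n y * Real.sqrt ((n : ℝ) / (20 * tz n y ^ 3)) = Real.sqrt ((n : ℝ) / (5 * tz n y)) := by
      rw [show 2 * tz n y = Real.sqrt ((2 * tz n y) ^ 2) from (Real.sqrt_sq (by positivity)).symm,
        ← Real.sqrt_mul (by positivity)]
      congr 1; field_simp; ring
    have h4 : Real.sqrt ((n : ℝ) / (5 * tz n y)) ≤ Real.sqrt n := by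
      refine Real.sqrt_le_sqrt ?_
      rw [div_le_iff₀ (by positivity)]
      nlinarith
    have h5 : Real.sqrt (n : ℝ) ≤ n := by
      rw [Real.sqrt_le_left (by positivity)]; nlinarith
    linarith
  calc Real.log (1 + d * Real.sqrt ((n : ℝ) / (20 * tz n y ^ 3))) ≤ Real.log ((n : ℝ) ^ 2) := by
        refine Real.log_le_log (by positivity) ?_
        nlinarith
    _ = 2 * Real.log n := by rw [Real.log_pow]; norm_num

/-! ### The partial one-sided integrals: the incomplete Fresnel term, uniformly in the cut -/

/-- **Right of the stationary height, any cut `T ∈ [t₀, 2t₀]`:**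
`‖∫_{t₀}^{T} e^{iF} − e^{iF(t₀)} F''(t₀)^{−1/2} fresnelS(√(2(F(T) − F(t₀))))‖ ≤ K_y (2 + log(1 + (T − t₀)√r))`. -/
theorem norm_integral_tz_right_sub_le {n : ℕ} {y T : ℝ} (hy : 0 < y) (hn : 2 * y ≤ n)
    (hT1 : tz n y ≤ T) (hT2 : T ≤ 2 * tz n y) :
    ‖(∫ t in (tz n y)..T, cexp (I * phF n y t))
        - cexp (I * phF n y (tz n y)) * ((Real.sqrt (phF2 n (tz n y)))⁻¹ : ℝ)
            * fresnelS (Real.sqrt (2 * (phF n y T - phF n y (tz n y))))‖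
      ≤ 2 * 320 ^ 3 * 40000 / y *
          (2 + Real.log (1 + (T - tz n y) * Real.sqrt ((n : ℝ) / (20 * tz n y ^ 3)))) := by
  have hs0 := tz_pos hy hn
  set s := tz n y with hs
  set r : ℝ := n / (20 * s ^ 3) with hr
  have hr0 : 0 < r := by
    have hn0 : (0 : ℝ) < n := by have : (0 : ℝ) < 2 * y := by positivity
                                 linarith
    positivity
  have hsub : Icc s T ⊆ Icc (s / 2) (2 * s) := Icc_subset_Icc (by linarith) hT2
  have h := stationaryPhase_uniform (P := phF n y) (P' := phF1 n y) (P'' := phF2 n) (P''' := phF3 n)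
    (α := s) (β := T) (c := s) (r := r) (A := 320) (lam3 := 100 * n / s ^ 4) le_rfl hT1 hr0 (by norm_num)
    (fun x _ ↦ hasDerivAt_phF n y x) (fun x _ ↦ hasDerivAt_phF1 n y x) (fun x _ ↦ hasDerivAt_phF2 n x)
    (fun x hx ↦ (sp_hyp hy hn (hsub hx)).1) (fun x hx ↦ (sp_hyp hy hn (hsub hx)).2) (phF1_tz hy hn)
  simp only [sub_self, mul_zero, Real.sqrt_zero, zero_mul, Real.log_one, add_zero] at h
  have h0 : fresnelS 0 = 0 := by simp [fresnelS]
  rw [h0, zero_add] at h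
  refine h.trans ?_
  have hK := errConst_le hy hn
  have hlog : 0 ≤ Real.log (1 + (T - s) * Real.sqrt r) :=
    Real.log_nonneg (by nlinarith [Real.sqrt_nonneg r, sub_nonneg.2 hT1])
  have h2 : 0 ≤ 2 + Real.log (1 + (T - s) * Real.sqrt r) := by linarith
  exact mul_le_mul_of_nonneg_right hK h2

/-- **Left of the stationary height, any cut `T ∈ [t₀/2, t₀]`:**
`‖∫_{T}^{t₀} e^{iF} − e^{iF(t₀)} F''(t₀)^{−1/2} fresnelS(√(2(F(T) − F(t₀))))‖ ≤ K_y (2 + log(1 + (t₀ − T)√r))`. -/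
theorem norm_integral_tz_left_sub_le {n : ℕ} {y T : ℝ} (hy : 0 < y) (hn : 2 * y ≤ n)
    (hT1 : tz n y / 2 ≤ T) (hT2 : T ≤ tz n y) :
    ‖(∫ t in T..(tz n y), cexp (I * phF n y t))
        - cexp (I * phF n y (tz n y)) * ((Real.sqrt (phF2 n (tz n y)))⁻¹ : ℝ)
            * fresnelS (Real.sqrt (2 * (phF n y T - phF n y (tz n y))))‖
      ≤ 2 * 320 ^ 3 * 40000 / y *
          (2 + Real.log (1 + (tz n y - T) * Real.sqrt ((n : ℝ) / (20 * tz n y ^ 3)))) := by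
  have hs0 := tz_pos hy hn
  set s := tz n y with hs
  set r : ℝ := n / (20 * s ^ 3) with hr
  have hr0 : 0 < r := by
    have hn0 : (0 : ℝ) < n := by have : (0 : ℝ) < 2 * y := by positivity
                                 linarith
    positivity
  have hsub : Icc T s ⊆ Icc (s / 2) (2 * s) := Icc_subset_Icc hT1 (by linarith)
  have h := stationaryPhase_uniform (P := phF n y) (P' := phF1 n y) (P'' := phF2 n) (P''' := phF3 n)
    (α := T) (β := s) (c := s) (r := r) (A := 320) (lam3 := 100 * n / s ^ 4) hT2 le_rfl hr0 (by norm_num)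
    (fun x _ ↦ hasDerivAt_phF n y x) (fun x _ ↦ hasDerivAt_phF1 n y x) (fun x _ ↦ hasDerivAt_phF2 n x)
    (fun x hx ↦ (sp_hyp hy hn (hsub hx)).1) (fun x hx ↦ (sp_hyp hy hn (hsub hx)).2) (phF1_tz hy hn)
  simp only [sub_self, mul_zero, Real.sqrt_zero, zero_mul, Real.log_one, add_zero] at h
  have h0 : fresnelS 0 = 0 := by simp [fresnelS]
  rw [h0, add_zero] at h
  refine h.trans ?_
  have hK := errConst_le hy hn
  have hlog : 0 ≤ Real.log (1 + (s - T) * Real.sqrt r) :=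
    Real.log_nonneg (by nlinarith [Real.sqrt_nonneg r, sub_nonneg.2 hT2])
  have h2 : 0 ≤ 2 + Real.log (1 + (s - T) * Real.sqrt r) := by linarith
  exact mul_le_mul_of_nonneg_right hK h2

/-! ### The complete one-sided integrals: the same half `fresnelLim` on both sides -/

/-- The Fresnel variable at distance `t₀` (resp. `t₀/2`) from the stationary point is large: for `x ∈ [t₀/2, 2t₀]`,
`F''(t₀)^{−1/2} · 2/√(2(F(x) − F(t₀))) ≤ 2/(r |x − t₀|)` (`F(x) − F(t₀) ≥ r(x − t₀)²/2`, `F''(t₀) ≥ r`). -/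
theorem inv_sqrt_mul_fresnel_tail_le {n : ℕ} {y x : ℝ} (hy : 0 < y) (hn : 2 * y ≤ n)
    (hx : x ∈ Icc (tz n y / 2) (2 * tz n y)) (hne : x ≠ tz n y) :
    0 < Real.sqrt (2 * (phF n y x - phF n y (tz n y))) ∧
      (Real.sqrt (phF2 n (tz n y)))⁻¹ * (2 / Real.sqrt (2 * (phF n y x - phF n y (tz n y))))
        ≤ 2 / ((n : ℝ) / (20 * tz n y ^ 3) * |x - tz n y|) := by
  have hs0 := tz_pos hy hn
  set s := tz n y with hs
  set r : ℝ := n / (20 * s ^ 3) with hr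
  have hn0 : (0 : ℝ) < n := by have : (0 : ℝ) < 2 * y := by positivity
                               linarith
  have hr0 : 0 < r := by positivity
  have hsI : s ∈ Icc (s / 2) (2 * s) := ⟨by linarith, by linarith⟩
  -- `F(x) − F(t₀) ≥ r (x − t₀)²/2` on either side (`LogStatPhaseHyp.value_bounds` and its reflection)
  have hval : r * (x - s) ^ 2 / 2 ≤ phF n y x - phF n y s := by
    rcases lt_or_gt_of_ne hne with hlt | hgt
    · -- left: reflect
      have hsub : Icc x s ⊆ Icc (s / 2) (2 * s) := Icc_subset_Icc hx.1 (by linarith)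
      have hrefl : ∀ u ∈ Icc s (2 * s - x), 2 * s - u ∈ Icc x s := fun u hu ↦ ⟨by linarith [hu.2], by linarith [hu.1]⟩
      have hd : ∀ u : ℝ, HasDerivAt (fun u : ℝ ↦ 2 * s - u) (-1) u := fun u ↦ by
        simpa using (hasDerivAt_id u).const_sub (2 * s)
      have HL : LogStatPhaseHyp (fun u ↦ phF n y (2 * s - u)) (fun u ↦ -phF1 n y (2 * s - u))
          (fun u ↦ phF2 n (2 * s - u)) (fun u ↦ -phF3 n (2 * s - u)) s (2 * s - x) r 320 (100 * n / s ^ 4) :=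
        ⟨by linarith, hr0, by norm_num,
          fun u _ ↦ ((hasDerivAt_phF n y (2 * s - u)).comp u (hd u)).congr_deriv (by ring),
          fun u _ ↦ (((hasDerivAt_phF1 n y (2 * s - u)).comp u (hd u)).neg).congr_deriv (by ring),
          fun u _ ↦ ((hasDerivAt_phF2 n (2 * s - u)).comp u (hd u)).congr_deriv (by ring),
          fun u hu ↦ (sp_hyp hy hn (hsub (hrefl u hu))).1,
          fun u hu ↦ by rw [abs_neg]; exact (sp_hyp hy hn (hsub (hrefl u hu))).2,
          by rw [show 2 * s - s = s by ring, phF1_tz hy hn, neg_zero]⟩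
      have := (HL.value_bounds (x := 2 * s - x) ⟨by linarith, le_rfl⟩).1
      simp only [show 2 * s - (2 * s - x) = x by ring, show 2 * s - s = s by ring] at this
      calc r * (x - s) ^ 2 / 2 = r * (2 * s - x - s) ^ 2 / 2 := by ring
        _ ≤ phF n y x - phF n y s := this
    · have hsub : Icc s x ⊆ Icc (s / 2) (2 * s) := Icc_subset_Icc (by linarith) hx.2
      have HR : LogStatPhaseHyp (phF n y) (phF1 n y) (phF2 n) (phF3 n) s x r 320 (100 * n / s ^ 4) :=
        ⟨hgt, hr0, by norm_num, fun u _ ↦ hasDerivAt_phF n y u, fun u _ ↦ hasDerivAt_phF1 n y u,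
          fun u _ ↦ hasDerivAt_phF2 n u, fun u hu ↦ (sp_hyp hy hn (hsub hu)).1,
          fun u hu ↦ (sp_hyp hy hn (hsub hu)).2, phF1_tz hy hn⟩
      exact (HR.value_bounds (x := x) ⟨hgt.le, le_rfl⟩).1
  have hd0 : 0 < |x - s| := abs_pos.2 (sub_ne_zero.2 hne)
  have hlow : Real.sqrt r * |x - s| ≤ Real.sqrt (2 * (phF n y x - phF n y s)) := by
    rw [show Real.sqrt r * |x - s| = Real.sqrt (r * (x - s) ^ 2) by
      rw [Real.sqrt_mul hr0.le, Real.sqrt_sq_eq_abs]]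
    exact Real.sqrt_le_sqrt (by linarith)
  have hpos : 0 < Real.sqrt r * |x - s| := by positivity
  have hU0 : 0 < Real.sqrt (2 * (phF n y x - phF n y s)) := hpos.trans_le hlow
  refine ⟨hU0, ?_⟩
  -- `F''(t₀) ≥ r`
  have hL : r ≤ phF2 n s := (sp_hyp hy hn hsI).1.1
  have hsr : Real.sqrt r ≤ Real.sqrt (phF2 n s) := Real.sqrt_le_sqrt hL
  have hsr0 : 0 < Real.sqrt r := Real.sqrt_pos.2 hr0
  calc (Real.sqrt (phF2 n s))⁻¹ * (2 / Real.sqrt (2 * (phF n y x - phF n y s)))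
      ≤ (Real.sqrt r)⁻¹ * (2 / (Real.sqrt r * |x - s|)) := by
        gcongr
    _ = 2 / (r * |x - s|) := by
        field_simp
        rw [Real.sq_sqrt hr0.le]

/-- **Complete right half:** for `L ≥ 2t₀`,
`‖∫_{t₀}^{L} e^{iF} − e^{iF(t₀)} F''(t₀)^{−1/2} fresnelLim‖ ≤ K_y(2 + 2 log n) + 44/y`
(`[t₀, 2t₀]`: uniform stationary phase + `‖fresnelS X − fresnelLim‖ ≤ 2/X` with `2/(r t₀) ≤ 40/y`; `[2t₀, L]`: `4/y`). -/
theorem norm_integral_tz_Ioi_sub_le {n : ℕ} {y L : ℝ} (hy : 0 < y) (hn : 2 * y ≤ n) (hn2 : 2 ≤ n)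
    (hL : 2 * tz n y ≤ L) :
    ‖(∫ t in (tz n y)..L, cexp (I * phF n y t))
        - cexp (I * phF n y (tz n y)) * ((Real.sqrt (phF2 n (tz n y)))⁻¹ : ℝ) * fresnelLim‖
      ≤ 2 * 320 ^ 3 * 40000 / y * (2 + 2 * Real.log n) + 44 / y := by
  obtain ⟨hsq, h1, _, _⟩ := tz_facts hy hn
  have hs0 := tz_pos hy hn
  set s := tz n y with hs
  set r : ℝ := n / (20 * s ^ 3) with hr
  have hn0 : (0 : ℝ) < n := by have : (0 : ℝ) < 2 * y := by positivity
                               linarith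
  have hr0 : 0 < r := by positivity
  set M : ℂ := cexp (I * phF n y s) * ((Real.sqrt (phF2 n s))⁻¹ : ℝ) with hM
  have hMn : ‖M‖ = (Real.sqrt (phF2 n s))⁻¹ := by
    rw [hM, norm_mul, Complex.norm_exp_I_mul_ofReal, one_mul, Complex.norm_real, Real.norm_eq_abs,
      abs_of_nonneg (inv_nonneg.2 (Real.sqrt_nonneg _))]
  -- split `∫_{t₀}^{L} = ∫_{t₀}^{2t₀} + ∫_{2t₀}^{L}`
  have hc : Continuous fun t ↦ cexp (I * phF n y t) := by
    have := continuous_phF n y; fun_prop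
  have hsplit : (∫ t in s..L, cexp (I * phF n y t))
      = (∫ t in s..(2 * s), cexp (I * phF n y t)) + ∫ t in (2 * s)..L, cexp (I * phF n y t) :=
    (intervalIntegral.integral_add_adjacent_intervals (hc.intervalIntegrable _ _) (hc.intervalIntegrable _ _)).symm
  have hA := norm_integral_tz_right_sub_le hy hn (T := 2 * s) (by linarith) le_rfl
  have hB := norm_right_piece hy hn (L := L) hL
  -- `fresnelS(U(2t₀)) → fresnelLim`
  have h2sI : 2 * s ∈ Icc (s / 2) (2 * s) := ⟨by linarith, le_rfl⟩
  obtain ⟨hU0, hUb⟩ := inv_sqrt_mul_fresnel_tail_le hy hn h2sI (by linarith)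
  have hF := norm_fresnelS_sub_fresnelLim_le hU0
  have hC : ‖M * fresnelS (Real.sqrt (2 * (phF n y (2 * s) - phF n y s))) - M * fresnelLim‖ ≤ 40 / y := by
    rw [← mul_sub, norm_mul, hMn]
    refine (mul_le_mul_of_nonneg_left hF (inv_nonneg.2 (Real.sqrt_nonneg _))).trans (hUb.trans ?_)
    rw [show |2 * s - s| = s by rw [show 2 * s - s = s by ring, abs_of_pos hs0]]
    have hs2n : s ^ 2 / n ≤ 1 / y := by
      have : s ^ 2 ≤ n / y := by rw [hsq]; linarith
      calc s ^ 2 / n ≤ (n / y) / n := by gcongr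
        _ = 1 / y := by field_simp
    calc 2 / (r * s) = 40 * (s ^ 2 / n) := by rw [hr]; field_simp; norm_num
      _ ≤ 40 * (1 / y) := by gcongr
      _ = 40 / y := by ring
  have hlog := log_bound hy hn hn2 (d := 2 * s - s) (by linarith) (by linarith)
  have hK0 : 0 ≤ 2 * (320 : ℝ) ^ 3 * 40000 / y := by positivity
  have hA' : ‖(∫ t in s..(2 * s), cexp (I * phF n y t)) - M * fresnelS (Real.sqrt (2 * (phF n y (2 * s) - phF n y s)))‖
      ≤ 2 * 320 ^ 3 * 40000 / y * (2 + 2 * Real.log n) := by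
    refine hA.trans (mul_le_mul_of_nonneg_left ?_ hK0)
    linarith
  rw [hsplit]
  calc ‖(∫ t in s..(2 * s), cexp (I * phF n y t)) + (∫ t in (2 * s)..L, cexp (I * phF n y t)) - M * fresnelLim‖
      = ‖((∫ t in s..(2 * s), cexp (I * phF n y t)) - M * fresnelS (Real.sqrt (2 * (phF n y (2 * s) - phF n y s))))
          + (M * fresnelS (Real.sqrt (2 * (phF n y (2 * s) - phF n y s))) - M * fresnelLim)
          + ∫ t in (2 * s)..L, cexp (I * phF n y t)‖ := by ring_nf
    _ ≤ 2 * 320 ^ 3 * 40000 / y * (2 + 2 * Real.log n) + 40 / y + 4 / y := by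
        refine (norm_add_le _ _).trans (add_le_add ((norm_add_le _ _).trans (add_le_add hA' hC)) hB)
    _ = _ := by ring

/-- **Complete left half:** `‖∫_0^{t₀} e^{iF} − e^{iF(t₀)} F''(t₀)^{−1/2} fresnelLim‖ ≤ K_y(2 + 2 log n) + 82/y`
(`[0, t₀/2]`: `2/y`; `[t₀/2, t₀]`: uniform stationary phase + `2/(r t₀/2) ≤ 80/y`). -/
theorem norm_integral_zero_tz_sub_le {n : ℕ} {y : ℝ} (hy : 0 < y) (hn : 2 * y ≤ n) (hn2 : 2 ≤ n) :
    ‖(∫ t in (0 : ℝ)..(tz n y), cexp (I * phF n y t))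
        - cexp (I * phF n y (tz n y)) * ((Real.sqrt (phF2 n (tz n y)))⁻¹ : ℝ) * fresnelLim‖
      ≤ 2 * 320 ^ 3 * 40000 / y * (2 + 2 * Real.log n) + 82 / y := by
  obtain ⟨hsq, h1, _, _⟩ := tz_facts hy hn
  have hs0 := tz_pos hy hn
  set s := tz n y with hs
  set r : ℝ := n / (20 * s ^ 3) with hr
  have hn0 : (0 : ℝ) < n := by have : (0 : ℝ) < 2 * y := by positivity
                               linarith
  have hr0 : 0 < r := by positivity
  set M : ℂ := cexp (I * phF n y s) * ((Real.sqrt (phF2 n s))⁻¹ : ℝ) with hM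
  have hMn : ‖M‖ = (Real.sqrt (phF2 n s))⁻¹ := by
    rw [hM, norm_mul, Complex.norm_exp_I_mul_ofReal, one_mul, Complex.norm_real, Real.norm_eq_abs,
      abs_of_nonneg (inv_nonneg.2 (Real.sqrt_nonneg _))]
  have hc : Continuous fun t ↦ cexp (I * phF n y t) := by
    have := continuous_phF n y; fun_prop
  have hsplit : (∫ t in (0 : ℝ)..s, cexp (I * phF n y t))
      = (∫ t in (0 : ℝ)..(s / 2), cexp (I * phF n y t)) + ∫ t in (s / 2)..s, cexp (I * phF n y t) :=
    (intervalIntegral.integral_add_adjacent_intervals (hc.intervalIntegrable _ _) (hc.intervalIntegrable _ _)).symm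
  have hA := norm_integral_tz_left_sub_le hy hn (T := s / 2) le_rfl (by linarith)
  have hB := norm_left_piece hy hn
  have h2sI : s / 2 ∈ Icc (s / 2) (2 * s) := ⟨le_rfl, by linarith⟩
  obtain ⟨hU0, hUb⟩ := inv_sqrt_mul_fresnel_tail_le hy hn h2sI (by linarith)
  have hF := norm_fresnelS_sub_fresnelLim_le hU0
  have hC : ‖M * fresnelS (Real.sqrt (2 * (phF n y (s / 2) - phF n y s))) - M * fresnelLim‖ ≤ 80 / y := by
    rw [← mul_sub, norm_mul, hMn]
    refine (mul_le_mul_of_nonneg_left hF (inv_nonneg.2 (Real.sqrt_nonneg _))).trans (hUb.trans ?_)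
    rw [show |s / 2 - s| = s / 2 by rw [show s / 2 - s = -(s / 2) by ring, abs_neg, abs_of_pos (half_pos hs0)]]
    have hs2n : s ^ 2 / n ≤ 1 / y := by
      have : s ^ 2 ≤ n / y := by rw [hsq]; linarith
      calc s ^ 2 / n ≤ (n / y) / n := by gcongr
        _ = 1 / y := by field_simp
    calc 2 / (r * (s / 2)) = 80 * (s ^ 2 / n) := by rw [hr]; field_simp; ring
      _ ≤ 80 * (1 / y) := by gcongr
      _ = 80 / y := by ring
  have hlog := log_bound hy hn hn2 (d := s - s / 2) (by linarith) (by linarith)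
  have hK0 : 0 ≤ 2 * (320 : ℝ) ^ 3 * 40000 / y := by positivity
  have hA' : ‖(∫ t in (s / 2)..s, cexp (I * phF n y t)) - M * fresnelS (Real.sqrt (2 * (phF n y (s / 2) - phF n y s)))‖
      ≤ 2 * 320 ^ 3 * 40000 / y * (2 + 2 * Real.log n) := by
    refine hA.trans (mul_le_mul_of_nonneg_left ?_ hK0)
    linarith
  rw [hsplit]
  calc ‖(∫ t in (0 : ℝ)..(s / 2), cexp (I * phF n y t)) + (∫ t in (s / 2)..s, cexp (I * phF n y t)) - M * fresnelLim‖
      = ‖(∫ t in (0 : ℝ)..(s / 2), cexp (I * phF n y t))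
          + (((∫ t in (s / 2)..s, cexp (I * phF n y t)) - M * fresnelS (Real.sqrt (2 * (phF n y (s / 2) - phF n y s))))
            + (M * fresnelS (Real.sqrt (2 * (phF n y (s / 2) - phF n y s))) - M * fresnelLim))‖ := by ring_nf
    _ ≤ 2 / y + (2 * 320 ^ 3 * 40000 / y * (2 + 2 * Real.log n) + 80 / y) :=
        (norm_add_le _ _).trans (add_le_add hB ((norm_add_le _ _).trans (add_le_add hA' hC)))
    _ = _ := by ring

end BridgeFresnel

end Summit.RiemannHypothesis.RiemannHypothesis.Theorems.LiTheory

end
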